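import Mathlib.Data.Nat.Digits.Lemmas
import Mathlib.Data.Nat.Log
import Mathlib.Algebra.Field.ZMod
import Literature.Computability.MetaComplexity.LowDegreeClosure
import HarnessLib

/-!
# The Keevash–Sudakov lower bound on the affine Hilbert function of a point set of the cube

For `S ⊆ {0,1}ⁿ` and a field `F`, `h_S(d) = hilbertFn F S d` (`LowDegreeClosure.lean`) is the
`F`-dimension of the space of restrictions to `S` of multilinear polynomials of degree `≤ d`.

**Theorem** (Keevash–Sudakov 2005; Ben-Eliezer–Hod–Lovett 2012; Golovnev–Guo–Hatami–Nagargoje–Yan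
2024, Corollary 1, case `q = 2`: "for every `n, k, d ∈ ℕ` where `k ≤ 2ⁿ`, and every `S ⊆ 𝔽₂ⁿ` of
size `|S| = k`, `h_S(d, 𝔽₂) ≥ C(⌊log k⌋, ≤ d)`"), here over an arbitrary field `F` (the restrictions
are of MULTILINEAR polynomials on `{0,1}ⁿ ⊆ Fⁿ`, which is the `𝔽₂ⁿ` situation for `F = 𝔽₂`):
`sum_choose_log_card_le_hilbertFn : Σ_{j ≤ d} C(⌊log₂ |S|⌋, j) ≤ hilbertFn F S d` (`S ≠ ∅`).

Proof (ours; the printed proofs use compression to the lexicographic down-set `M(k)`, GGHNY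
Theorem 2, or Gröbner/standard monomials, BEHL). Let `G(k, e) = #{x < k : s₂(x) < e}` (`s₂` = binary
digit sum), i.e. the number of points of Hamming weight `< e` among the `k` lexicographically first
points of the cube — the extremal value. (1) `G` obeys the parity recursion
`G(2y, e+1) = G(y, e+1) + G(y, e)`, `G(2y+1, e+1) = G(y+1, e+1) + G(y, e)`, hence `G(2ᵐ, d+1) =
C(m, ≤ d)`; (2) the splitting inequality `G(a + b, e+1) ≤ G(a, e+1) + G(b, e)` for `b ≤ a` (strong
induction on `a + b` by parity; the odd–odd case uses `s₂(x+1) ≤ s₂(x) + 1`); (3) induction on `n`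
with the tree's face inequality `h_Y(D+1) ≥ h_{Y_c}(D+1) + h_{Y_{¬c}}(D)` (`hilbertFn_face_add_le`,
Kopparty–Srinivasan Cor. A.4 / Nie–Wang Thm 4.1, inductive form), applied with `c` the larger face,
gives `G(|S|, d+1) ≤ h_S(d)`; (4) monotonicity of `G` in `k` and `2^{⌊log₂ k⌋} ≤ k`.
All auxiliary statements are private; only the cited theorem (and its `𝔽₂` reading) is exported.
NOT here: the exact extremal statement `min_{|S| = k} h_S(d) = |M(k)_{≤ d}|` (GGHNY Cor. 1, first
display) — (3) proves `≥`; the matching construction is not formalised.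

## References
* P. Keevash, B. Sudakov, *Set systems with restricted cross-intersections and the minimum rank of
  inclusion matrices*, SIAM J. Discrete Math. 18 (2005) 713–727 [KeevashSudakov2005].
* A. Golovnev, Z. Guo, P. Hatami, S. Nagargoje, C. Yan, *Hilbert functions and low-degree randomness
  extractors*, RANDOM 2024 / ECCC TR24-091, arXiv:2405.10277, Corollary 1 [GolovnevEtAl2024].
-/

noncomputable section

namespace Literature.Computability.MetaComplexity

namespace Smolensky

open Finset

variable {F : Type*} [Field F] {n : ℕ}

/-! ### Binary digit sums -/

/-- `s₂(2y) = s₂(y)`. [folklore] -/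
private theorem digitSum_two_mul (y : ℕ) : (Nat.digits 2 (2 * y)).sum = (Nat.digits 2 y).sum := by
  rcases Nat.eq_zero_or_pos y with rfl | hy
  · simp
  · rw [Nat.digits_def' (by norm_num) (by omega)]
    have h1 : 2 * y % 2 = 0 := by omega
    have h2 : 2 * y / 2 = y := by omega
    rw [h1, h2, List.sum_cons, zero_add]

/-- `s₂(2y+1) = s₂(y) + 1`. [folklore] -/
private theorem digitSum_two_mul_add_one (y : ℕ) :
    (Nat.digits 2 (2 * y + 1)).sum = (Nat.digits 2 y).sum + 1 := by
  rw [Nat.digits_def' (by norm_num) (by omega)]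
  have h1 : (2 * y + 1) % 2 = 1 := by omega
  have h2 : (2 * y + 1) / 2 = y := by omega
  rw [h1, h2, List.sum_cons, add_comm]

/-- `s₂(x+1) ≤ s₂(x) + 1`. [folklore] -/
private theorem digitSum_succ_le (x : ℕ) :
    (Nat.digits 2 (x + 1)).sum ≤ (Nat.digits 2 x).sum + 1 := by
  induction x using Nat.strong_induction_on with
  | _ x ih =>
    obtain ⟨y, rfl | rfl⟩ := Nat.even_or_odd' x
    · rw [digitSum_two_mul_add_one, digitSum_two_mul]
    · have e : 2 * y + 1 + 1 = 2 * (y + 1) := by ring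
      rw [e, digitSum_two_mul, digitSum_two_mul_add_one]
      rcases Nat.eq_zero_or_pos y with rfl | hy
      · simp
      · have := ih y (by omega)
        omega

/-- `s₂(x) = 0` only for `x = 0`. [folklore] -/
private theorem eq_zero_of_digitSum_eq_zero {x : ℕ} (h : (Nat.digits 2 x).sum = 0) : x = 0 := by
  induction x using Nat.strong_induction_on with
  | _ x ih =>
    obtain ⟨y, rfl | rfl⟩ := Nat.even_or_odd' x
    · rcases Nat.eq_zero_or_pos y with rfl | hy
      · rfl
      · rw [digitSum_two_mul] at h
        have := ih y (by omega) h
        omega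
    · rw [digitSum_two_mul_add_one] at h
      omega

/-! ### The extremal counting function `G(k, e) = #{x < k : s₂(x) < e}` -/

/-- `G(k+1, e) = G(k, e) + [s₂(k) < e]`. [folklore] -/
private theorem G_succ (k e : ℕ) :
    ((range (k + 1)).filter fun x => (Nat.digits 2 x).sum < e).card =
      ((range k).filter fun x => (Nat.digits 2 x).sum < e).card +
        (if (Nat.digits 2 k).sum < e then 1 else 0) := by
  rw [range_add_one, filter_insert]
  split_ifs with h
  · rw [card_insert_of_notMem (by simp)]
  · rfl

/-- `G(0, e) = 0`. [folklore] -/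
private theorem G_zero (e : ℕ) :
    ((range 0).filter fun x => (Nat.digits 2 x).sum < e).card = 0 := by
  simp

/-- `G(k, 0) = 0`. [folklore] -/
private theorem G_zero_right (k : ℕ) :
    ((range k).filter fun x => (Nat.digits 2 x).sum < 0).card = 0 := by
  simp

/-- `G(k, 1) ≤ 1` (only `x = 0` has digit sum `0`). [folklore] -/
private theorem G_one_le (k : ℕ) :
    ((range k).filter fun x => (Nat.digits 2 x).sum < 1).card ≤ 1 := by
  refine card_le_one.2 fun x hx y hy => ?_
  rw [mem_filter] at hx hy
  rw [eq_zero_of_digitSum_eq_zero (Nat.lt_one_iff.1 hx.2),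
    eq_zero_of_digitSum_eq_zero (Nat.lt_one_iff.1 hy.2)]

/-- `1 ≤ G(k, e)` for `k, e ≥ 1` (`x = 0` is counted). [folklore] -/
private theorem one_le_G {k e : ℕ} (hk : 0 < k) (he : 0 < e) :
    1 ≤ ((range k).filter fun x => (Nat.digits 2 x).sum < e).card := by
  refine card_pos.2 ⟨0, ?_⟩
  rw [mem_filter, mem_range]
  exact ⟨hk, by simpa using he⟩

/-- `G` is monotone in `k`. [folklore] -/
private theorem G_mono {k k' : ℕ} (h : k ≤ k') (e : ℕ) :
    ((range k).filter fun x => (Nat.digits 2 x).sum < e).card ≤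
      ((range k').filter fun x => (Nat.digits 2 x).sum < e).card :=
  card_le_card (filter_subset_filter _ (range_subset_range.2 h))

/-- Parity recursion: `G(2y, e+1) = G(y, e+1) + G(y, e)` and `G(2y+1, e+1) = G(y+1, e+1) + G(y, e)`
(even `x = 2x'` has `s₂(x) = s₂(x')`, odd `x = 2x'+1` has `s₂(x) = s₂(x') + 1`). [folklore] -/
private theorem G_parity (y e : ℕ) :
    ((range (2 * y)).filter fun x => (Nat.digits 2 x).sum < e + 1).card =
      ((range y).filter fun x => (Nat.digits 2 x).sum < e + 1).card +
        ((range y).filter fun x => (Nat.digits 2 x).sum < e).card ∧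
    ((range (2 * y + 1)).filter fun x => (Nat.digits 2 x).sum < e + 1).card =
      ((range (y + 1)).filter fun x => (Nat.digits 2 x).sum < e + 1).card +
        ((range y).filter fun x => (Nat.digits 2 x).sum < e).card := by
  induction y with
  | zero =>
    refine ⟨by simp, ?_⟩
    rw [Nat.mul_zero, G_zero, add_zero]
  | succ y ih =>
    obtain ⟨ih1, ih2⟩ := ih
    have hA : ((range (2 * (y + 1))).filter fun x => (Nat.digits 2 x).sum < e + 1).card =
        ((range (y + 1)).filter fun x => (Nat.digits 2 x).sum < e + 1).card +
          ((range (y + 1)).filter fun x => (Nat.digits 2 x).sum < e).card := by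
      have e1 : 2 * (y + 1) = 2 * y + 1 + 1 := by ring
      rw [e1, G_succ, ih2, digitSum_two_mul_add_one, G_succ y e]
      have : ((Nat.digits 2 y).sum + 1 < e + 1) = ((Nat.digits 2 y).sum < e) := by
        apply propext; omega
      simp only [this]
      ring
    refine ⟨hA, ?_⟩
    rw [G_succ, hA, digitSum_two_mul, G_succ (y + 1) (e + 1)]
    ring

/-- `G(2ᵐ, e) = Σ_{j < e} C(m, j)`. [folklore] -/
private theorem G_two_pow (m e : ℕ) :
    ((range (2 ^ m)).filter fun x => (Nat.digits 2 x).sum < e).card =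
      ∑ j ∈ range e, m.choose j := by
  induction m generalizing e with
  | zero =>
    cases e with
    | zero => simp
    | succ e =>
      rw [pow_zero, show (1 : ℕ) = 0 + 1 from rfl, G_succ, G_zero, sum_range_succ']
      simp
  | succ m ih =>
    cases e with
    | zero => simp
    | succ e =>
      rw [pow_succ, mul_comm, (G_parity (2 ^ m) e).1, ih, ih, sum_range_succ', sum_range_succ']
      simp only [Nat.choose_succ_succ, sum_add_distrib, Nat.choose_zero_right]
      ring

/-- **Splitting inequality**: `G(a + b, e+1) ≤ G(a, e+1) + G(b, e)` for `b ≤ a`. [folklore] -/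
private theorem G_split : ∀ s a b e : ℕ, a + b = s → b ≤ a →
    ((range (a + b)).filter fun x => (Nat.digits 2 x).sum < e + 1).card ≤
      ((range a).filter fun x => (Nat.digits 2 x).sum < e + 1).card +
        ((range b).filter fun x => (Nat.digits 2 x).sum < e).card := by
  intro s
  induction s using Nat.strong_induction_on with
  | _ s ih =>
    intro a b e hs hba
    -- trivial when `b = 0`
    rcases Nat.eq_zero_or_pos b with rfl | hb
    · simp
    -- the case `e = 0`: `G(·, 1) ∈ {0, 1}`
    cases e with
    | zero =>
      rw [G_zero_right, add_zero]
      exact (G_one_le _).trans (one_le_G (by omega) (by norm_num))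
    | succ e =>
      obtain ⟨α, ha⟩ := Nat.even_or_odd' a
      obtain ⟨β, hb'⟩ := Nat.even_or_odd' b
      rcases ha with rfl | rfl <;> rcases hb' with rfl | rfl
      · -- a = 2α, b = 2β
        have e1 : 2 * α + 2 * β = 2 * (α + β) := by ring
        rw [e1, (G_parity (α + β) (e + 1)).1, (G_parity α (e + 1)).1, (G_parity β e).1]
        have h1 := ih (α + β) (by omega) α β (e + 1) rfl (by omega)
        have h2 := ih (α + β) (by omega) α β e rfl (by omega)
        omega
      · -- a = 2α, b = 2β+1  (then β < α)
        have e1 : 2 * α + (2 * β + 1) = 2 * (α + β) + 1 := by ring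
        rw [e1, (G_parity (α + β) (e + 1)).2, (G_parity α (e + 1)).1, (G_parity β e).2]
        have e2 : α + β + 1 = α + (β + 1) := by ring
        rw [e2]
        have h1 := ih (α + (β + 1)) (by omega) α (β + 1) (e + 1) rfl (by omega)
        have h2 := ih (α + β) (by omega) α β e rfl (by omega)
        omega
      · -- a = 2α+1, b = 2β
        have e1 : 2 * α + 1 + 2 * β = 2 * (α + β) + 1 := by ring
        rw [e1, (G_parity (α + β) (e + 1)).2, (G_parity α (e + 1)).2, (G_parity β e).1]
        have e2 : α + β + 1 = (α + 1) + β := by ring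
        rw [e2]
        have h1 := ih (α + 1 + β) (by omega) (α + 1) β (e + 1) rfl (by omega)
        have h2 := ih (α + β) (by omega) α β e rfl (by omega)
        omega
      · -- a = 2α+1, b = 2β+1: the interesting case
        have e1 : 2 * α + 1 + (2 * β + 1) = 2 * (α + β + 1) := by ring
        rw [e1, (G_parity (α + β + 1) (e + 1)).1, (G_parity α (e + 1)).2, (G_parity β e).2]
        -- `G(σ, e+1) = G(σ-1+1, …)` expansions at `σ = α + β + 1`
        have hstep1 := G_succ (α + β + 1) (e + 1 + 1)
        have hstep2 := G_succ (α + β) (e + 1)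
        have hds := digitSum_succ_le (α + β)
        have h2 := ih (α + β) (by omega) α β e rfl (by omega)
        rcases Nat.eq_zero_or_pos (α + β) with h0 | hpos
        · -- α = β = 0, i.e. a = b = 1
          have hα : α = 0 := by omega
          have hβ : β = 0 := by omega
          subst hα; subst hβ
          simp
        · have e2 : α + β + 1 + 1 = (α + 1) + (β + 1) := by ring
          have h1 := ih (α + 1 + (β + 1)) (by omega) (α + 1) (β + 1) (e + 1) rfl (by omega)
          rw [← e2] at h1
          rw [hstep1] at h1
          rw [hstep2]
          -- compare the two indicator terms via `hds`
          by_cases hc : (Nat.digits 2 (α + β)).sum < e + 1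
          · rw [if_pos hc]
            have hc' : (Nat.digits 2 (α + β + 1)).sum < e + 1 + 1 := by omega
            rw [if_pos hc'] at h1
            omega
          · rw [if_neg hc]
            split_ifs at h1 <;> omega

/-! ### Hilbert function: the two private facts of `LowDegreeClosure.lean` we need again -/

/-- `h_Y(D) ≥ 1` for non-empty `Y`. [folklore] -/
private theorem one_le_hilbertFn' {Y : Finset (Fin n → Bool)} (hY : Y.Nonempty) (D : ℕ) :
    1 ≤ hilbertFn F Y D := by
  obtain ⟨y, hy⟩ := hY
  have h1 : (1 : CubeFn F n) ∈ lowDeg F n D := by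
    rw [← mono_empty]
    exact mono_mem_lowDeg (by simp)
  have hmem : projOn F Y 1 ∈ (lowDeg F n D).map (projOn F Y) := Submodule.mem_map_of_mem h1
  have hne : projOn F Y (1 : CubeFn F n) ≠ 0 := by
    intro h
    have := congrFun h y
    simp [projOn, hy] at this
  unfold hilbertFn
  exact Module.finrank_pos_iff_exists_ne_zero.2
    ⟨⟨_, hmem⟩, fun h => hne ((Submodule.mk_eq_zero _ _).1 h)⟩

/-- `|Y| = |Y_false| + |Y_true|`. [folklore] -/
private theorem card_eq_card_face_add' (Y : Finset (Fin (n + 1) → Bool)) :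
    Y.card = (face false Y).card + (face true Y).card := by
  classical
  have hsplit : Y = (Y.filter fun z => z 0 = false) ∪ Y.filter fun z => z 0 = true := by
    ext z; cases h : z 0 <;> simp [h]
  have hdisj : Disjoint (Y.filter fun z => z 0 = false) (Y.filter fun z => z 0 = true) :=
    Finset.disjoint_filter.2 fun z _ h1 h2 => by simp [h1] at h2
  have hc : ∀ c : Bool, (Y.filter fun z => z 0 = c).card = (face c Y).card := by
    intro c
    refine Finset.card_bij (fun z _ => Fin.tail z) (fun z hz => ?_) (fun z hz w hw h => ?_)
      (fun x hx => ?_)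
    · rw [Finset.mem_filter] at hz
      simp only [face, Finset.mem_filter, Finset.mem_univ, true_and]
      rw [← hz.2, Fin.cons_self_tail]
      exact hz.1
    · rw [Finset.mem_filter] at hz hw
      rw [← Fin.cons_self_tail z, ← Fin.cons_self_tail w, h, hz.2, hw.2]
    · refine ⟨Fin.cons c x, ?_, Fin.tail_cons _ _⟩
      rw [Finset.mem_filter]
      simp only [face, Finset.mem_filter, Finset.mem_univ, true_and] at hx
      exact ⟨hx, Fin.cons_zero _ _⟩
  rw [← hc, ← hc, ← Finset.card_union_of_disjoint hdisj, ← hsplit]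

/-! ### The theorem -/

/-- The extremal count is a lower bound: `G(|S|, d+1) ≤ h_S(d)` (induction on `n` via the face
inequality, the larger face keeping degree `d`). [cite: GolovnevEtAl2024, Corollary 1 (proof via Theorem 2: the lexicographic down-set is extremal)] -/
private theorem G_card_le_hilbertFn : ∀ (n : ℕ) (S : Finset (Fin n → Bool)) (d : ℕ),
    ((range S.card).filter fun x => (Nat.digits 2 x).sum < d + 1).card ≤ hilbertFn F S d := by
  intro n
  induction n with
  | zero =>
    intro S d
    rcases S.eq_empty_or_nonempty with rfl | hS
    · simp
    · have hc : S.card ≤ 1 := by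
        have := Finset.card_le_univ S
        simpa using this
      calc ((range S.card).filter fun x => (Nat.digits 2 x).sum < d + 1).card
          ≤ ((range 1).filter fun x => (Nat.digits 2 x).sum < d + 1).card := G_mono hc _
        _ ≤ 1 := by
            refine (card_le_card (filter_subset _ _)).trans ?_
            simp
        _ ≤ hilbertFn F S d := one_le_hilbertFn' hS d
  | succ n ih =>
    intro S d
    cases d with
    | zero =>
      rcases S.eq_empty_or_nonempty with rfl | hS
      · simp
      · exact (G_one_le _).trans (one_le_hilbertFn' hS 0)
    | succ d =>
      obtain ⟨c, hc⟩ : ∃ c : Bool, (face (!c) S).card ≤ (face c S).card := by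
        rcases le_total (face true S).card (face false S).card with h | h
        · exact ⟨false, h⟩
        · exact ⟨true, h⟩
      have hcard : S.card = (face c S).card + (face (!c) S).card := by
        rw [card_eq_card_face_add' S]
        cases c
        · rfl
        · exact add_comm _ _
      have hface := hilbertFn_face_add_le (F := F) c S d
      have h1 := ih (face c S) (d + 1)
      have h2 := ih (face (!c) S) d
      have hsplit := G_split _ _ _ (d + 1) rfl hc
      rw [hcard]
      omega

/-- **Keevash–Sudakov / Ben-Eliezer–Hod–Lovett / Golovnev–Guo–Hatami–Nagargoje–Yan (Corollary 1,
`q = 2`)**: for every non-empty `S ⊆ {0,1}ⁿ` and every `d`,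
`Σ_{j ≤ d} C(⌊log₂ |S|⌋, j) ≤ h_S(d)` — the affine Hilbert function of a `k`-point set is at least
that of a subcube of dimension `⌊log₂ k⌋`. Printed for `𝔽₂` (and `𝔽_q`); the statement here is over
any field `F`, for restrictions of multilinear polynomials to `S ⊆ {0,1}ⁿ` (`hilbertFn F S d`).
[cite: GolovnevEtAl2024, Corollary 1] -/
theorem sum_choose_log_card_le_hilbertFn {S : Finset (Fin n → Bool)} (hS : S.Nonempty) (d : ℕ) :
    ∑ j ∈ range (d + 1), (Nat.log 2 S.card).choose j ≤ hilbertFn F S d := by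
  rw [← G_two_pow]
  exact (G_mono (Nat.pow_log_le_self 2 (card_pos.2 hS).ne') _).trans (G_card_le_hilbertFn n S d)

/-- The same bound in the original setting `F = 𝔽₂` (Keevash–Sudakov 2005; GGHNY 2024 Cor. 1):
`h_S(d, 𝔽₂) ≥ C(⌊log₂ |S|⌋, ≤ d)` (GGHNY attribute the `𝔽₂` case to Keevash–Sudakov 2005
[KeevashSudakov2005] and Ben-Eliezer–Hod–Lovett 2012). [cite: GolovnevEtAl2024, Corollary 1] -/
theorem keevashSudakov_hilbertFn_lower {S : Finset (Fin n → Bool)} (hS : S.Nonempty) (d : ℕ) :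
    ∑ j ∈ range (d + 1), (Nat.log 2 S.card).choose j ≤ hilbertFn (ZMod 2) S d :=
  sum_choose_log_card_le_hilbertFn hS d

/-! ### The Hilbert function as the dimension of honest restrictions `Y → F` -/

/-- For two linear maps with the same kernel, the images of a finite-dimensional submodule have the
same dimension (rank–nullity). [folklore] -/
private theorem finrank_map_eq_of_ker_eq {V₁ V₂ : Type*} [AddCommGroup V₁] [Module F V₁]
    [AddCommGroup V₂] [Module F V₂] {W : Type*} [AddCommGroup W] [Module F W]
    [FiniteDimensional F W] (f₁ : W →ₗ[F] V₁) (f₂ : W →ₗ[F] V₂)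
    (h : LinearMap.ker f₁ = LinearMap.ker f₂) (K : Submodule F W) :
    Module.finrank F (K.map f₁) = Module.finrank F (K.map f₂) := by
  have h1 := LinearMap.finrank_range_add_finrank_ker (f₁.domRestrict K)
  have h2 := LinearMap.finrank_range_add_finrank_ker (f₂.domRestrict K)
  rw [LinearMap.range_domRestrict, LinearMap.ker_domRestrict] at h1 h2
  rw [h] at h1
  omega

/-- `hilbertFn F Y D` (restrictions realised inside `CubeFn F n` as `P · 𝟙_Y`) equals the
dimension of the space of genuine restrictions `P|_Y : Y → F` of the degree-`≤ D` polynomials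
(GGHNY's `dim Γ_S(d)`; the shape used by the QuantumAdvantage cell qa-qnc0, planner file
Sketch5.lean `hilbertFn`). [cite: GolovnevEtAl2024, Definition 8 (the affine Hilbert function as dim_F Γ_S(d))] -/
theorem hilbertFn_eq_finrank_map_funLeft (Y : Finset (Fin n → Bool)) (D : ℕ) :
    hilbertFn F Y D = Module.finrank F ((lowDeg F n D).map
      (LinearMap.funLeft F F (Subtype.val : ↥Y → (Fin n → Bool)))) := by
  unfold hilbertFn
  apply finrank_map_eq_of_ker_eq
  ext v
  simp only [LinearMap.mem_ker]
  constructor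
  · intro h
    funext y
    have := congrFun h y.1
    simp only [projOn, LinearMap.coe_mk, AddHom.coe_mk, Pi.zero_apply] at this
    rw [if_pos y.2] at this
    simpa [LinearMap.funLeft_apply] using this
  · intro h
    funext x
    simp only [projOn, LinearMap.coe_mk, AddHom.coe_mk, Pi.zero_apply]
    split_ifs with hx
    · have := congrFun h ⟨x, hx⟩
      simpa [LinearMap.funLeft_apply] using this
    · rfl

/-- The bound in the restriction form: `Σ_{j ≤ d} C(⌊log₂ |S|⌋, j) ≤ dim_F {P|_S : deg P ≤ d}`.
[cite: GolovnevEtAl2024, Corollary 1] -/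
theorem sum_choose_log_card_le_finrank_restrict {S : Finset (Fin n → Bool)} (hS : S.Nonempty)
    (d : ℕ) :
    ∑ j ∈ range (d + 1), (Nat.log 2 S.card).choose j ≤ Module.finrank F ((lowDeg F n d).map
      (LinearMap.funLeft F F (Subtype.val : ↥S → (Fin n → Bool)))) := by
  rw [← hilbertFn_eq_finrank_map_funLeft]
  exact sum_choose_log_card_le_hilbertFn hS d

end Smolensky

end Literature.Computability.MetaComplexity
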